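import Summits.QuantumFields.YangMills.Theorems.ColdStartUniversalityLatticeLangevinChebyshevSpan
import Summits.QuantumFields.YangMills.Theorems.ColdStartUniversalityLatticeLangevinLatitudeEigen
import Summits.QuantumFields.YangMills.Theorems.ColdStartUniversalityLatticeLangevinHeatKernelSU2
import HarnessLib

/-!
# Route `ColdStartUniversality`, crux K_A1 `UniformColdStartMixing` (stmt-QuantumFields-24809), rung `stub_fixedCutoffMixing`:
# from ridge moments to ridge characteristic functions

Helper file (seat `ym-line-csu-p1`, g7).  Two finite measures `μ, ν` on `SU(2)^E` which integrate every latitude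
eigenfunction `y ↦ ∏_e U_{m_e}(⟨ρ g_e, ρ y_e⟩)` identically (`U_n = gegenbauerSum 1 n`, `⟨X, Y⟩ = ½ hsForm`) also integrate
identically (i) every product of finite `U`-combinations with complex coefficients (`integral_prod_sum_gegenbauer_eq`,
expansion of the product) and (ii) every ridge exponential `y ↦ exp(i Σ_e r_e ⟨ρ g_e, ρ y_e⟩)`
(`integral_cexp_ridge_eq`: Weierstrass in the `U`-basis on `[-1, 1]` edge by edge, `exists_sum_gegenbauerSum_near`, and a
product estimate).  Step (ii) is the input of the Cramér–Wold / characteristic-function identification of the law of the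
`β' = 0` SZZ dynamics (`…RidgeDeterminacy`).  No definition, no sorry.  RECORD-rung R3 plumbing; nothing here bears on
the mass gap.
-/

set_option autoImplicit false

noncomputable section

namespace Summit.QuantumFields.YangMills.Theorems.ColdStartUniversality

open MeasureTheory Finset
open scoped BigOperators
open Literature.MathematicalPhysics.QuantumFieldTheory
open Literature.MathematicalPhysics.QuantumLattice (fundamentalRep)
open Literature.Analysis.SpecialFunctions (gegenbauerSum)

variable {L : ℕ} [NeZero L]

/-- A product estimate: if `‖a_i‖ ≤ 1` and `‖a_i - b_i‖ ≤ δ` (`δ ≥ 0`) then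
`‖∏ a_i - ∏ b_i‖ ≤ |t| δ (1 + δ)^{|t|}`. [folklore] -/
theorem norm_prod_sub_prod_le {ι : Type*} (t : Finset ι) {a b : ι → ℂ} {δ : ℝ} (hδ : 0 ≤ δ)
    (ha : ∀ i ∈ t, ‖a i‖ ≤ 1) (hab : ∀ i ∈ t, ‖a i - b i‖ ≤ δ) :
    ‖∏ i ∈ t, a i - ∏ i ∈ t, b i‖ ≤ t.card * δ * (1 + δ) ^ t.card := by
  classical
  induction t using Finset.induction_on with
  | empty => simp
  | insert j t hj ih =>
    have ha' : ∀ i ∈ t, ‖a i‖ ≤ 1 := fun i hi => ha i (mem_insert_of_mem hi)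
    have hab' : ∀ i ∈ t, ‖a i - b i‖ ≤ δ := fun i hi => hab i (mem_insert_of_mem hi)
    have hb : ∀ i ∈ t, ‖b i‖ ≤ 1 + δ := by
      intro i hi
      calc ‖b i‖ = ‖a i - (a i - b i)‖ := by rw [sub_sub_cancel]
        _ ≤ ‖a i‖ + ‖a i - b i‖ := norm_sub_le _ _
        _ ≤ 1 + δ := add_le_add (ha' i hi) (hab' i hi)
    have hpb : ‖∏ i ∈ t, b i‖ ≤ (1 + δ) ^ t.card := by
      rw [norm_prod]
      calc ∏ i ∈ t, ‖b i‖ ≤ ∏ _i ∈ t, (1 + δ) := prod_le_prod (fun i _ => norm_nonneg _) hb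
        _ = (1 + δ) ^ t.card := prod_const _
    rw [prod_insert hj, prod_insert hj, card_insert_of_notMem hj]
    have hsplit : a j * ∏ i ∈ t, a i - b j * ∏ i ∈ t, b i =
        a j * (∏ i ∈ t, a i - ∏ i ∈ t, b i) + (a j - b j) * ∏ i ∈ t, b i := by ring
    rw [hsplit]
    have h1 : ‖a j * (∏ i ∈ t, a i - ∏ i ∈ t, b i)‖ ≤ t.card * δ * (1 + δ) ^ t.card := by
      rw [norm_mul]
      calc ‖a j‖ * ‖∏ i ∈ t, a i - ∏ i ∈ t, b i‖ ≤ 1 * (t.card * δ * (1 + δ) ^ t.card) :=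
            mul_le_mul (ha j (mem_insert_self j t)) (ih ha' hab') (norm_nonneg _) zero_le_one
        _ = t.card * δ * (1 + δ) ^ t.card := one_mul _
    have h2 : ‖(a j - b j) * ∏ i ∈ t, b i‖ ≤ δ * (1 + δ) ^ t.card := by
      rw [norm_mul]; exact mul_le_mul (hab j (mem_insert_self j t)) hpb (norm_nonneg _) hδ
    have h3 : (1 + δ) ^ t.card ≤ (1 + δ) ^ (t.card + 1) :=
      pow_le_pow_right₀ (by linarith) (Nat.le_succ _)
    calc ‖a j * (∏ i ∈ t, a i - ∏ i ∈ t, b i) + (a j - b j) * ∏ i ∈ t, b i‖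
        ≤ t.card * δ * (1 + δ) ^ t.card + δ * (1 + δ) ^ t.card := (norm_add_le _ _).trans (add_le_add h1 h2)
      _ = (t.card + 1 : ℝ) * δ * (1 + δ) ^ t.card := by ring
      _ ≤ (t.card + 1 : ℝ) * δ * (1 + δ) ^ (t.card + 1) :=
          mul_le_mul_of_nonneg_left h3 (by positivity)
      _ = ((t.card + 1 : ℕ) : ℝ) * δ * (1 + δ) ^ (t.card + 1) := by push_cast; ring

section Moments

variable {μ ν : Measure (GaugeConfig 3 L (Matrix.specialUnitaryGroup (Fin 2) ℂ))}

/-- The latitude `y ↦ ⟨ρ g, ρ y_e⟩` is continuous. [folklore] -/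
theorem continuous_latitude (g : Matrix.specialUnitaryGroup (Fin 2) ℂ) (e : Edge 3 L) :
    Continuous fun y : GaugeConfig 3 L (Matrix.specialUnitaryGroup (Fin 2) ℂ) =>
      hsForm 2 (fundamentalRep (Fin 2) g) (fundamentalRep (Fin 2) (y e)) / 2 := by
  have h := continuous_prod_gegenbauer_latitude (L := L) (fun _ => g) (Function.update (fun _ => 0) e 1)
  -- simpler: directly
  refine Continuous.div_const ?_ _
  have hc : Continuous fun V : GaugeConfig 3 L (Matrix.specialUnitaryGroup (Fin 2) ℂ) =>
      (fundamentalRep (Fin 2) (V e) : Matrix (Fin 2) (Fin 2) ℂ) :=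
    (Literature.MathematicalPhysics.QuantumLattice.continuous_fundamentalRep (n := Fin 2)).comp (continuous_apply e)
  simp_rw [hsForm_eq_sum_entries]
  refine continuous_finsetSum _ fun i _ => continuous_finsetSum _ fun j _ => ?_
  exact Complex.continuous_re.comp (continuous_const.mul (Complex.continuous_conj.comp
    ((continuous_apply j).comp ((continuous_apply i).comp hc))))

/-- The latitude lies in `[-1, 1]`. [folklore] -/
theorem latitude_mem_Icc (g : Matrix.specialUnitaryGroup (Fin 2) ℂ) (y : Matrix.specialUnitaryGroup (Fin 2) ℂ) :
    hsForm 2 (fundamentalRep (Fin 2) g) (fundamentalRep (Fin 2) y) / 2 ∈ Set.Icc (-1 : ℝ) 1 := by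
  have h := abs_re_trace_div_two_le (y * g⁻¹)
  have heq : ((((y * g⁻¹ : Matrix.specialUnitaryGroup (Fin 2) ℂ)) : Matrix (Fin 2) (Fin 2) ℂ).trace.re) / 2 =
      hsForm 2 (fundamentalRep (Fin 2) g) (fundamentalRep (Fin 2) y) / 2 := by
    have h1 := su2Char_mul_inv_eq_gegenbauerSum 1 g y
    rw [su2Char_eq_gegenbauerSum, Literature.Analysis.SpecialFunctions.gegenbauerSum_one,
      Literature.Analysis.SpecialFunctions.gegenbauerSum_one] at h1
    linarith
  rw [heq] at h
  exact ⟨(abs_le.1 h).1, (abs_le.1 h).2⟩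

/-- **From `U`-moments to products of `U`-combinations** (complex coefficients): if `μ, ν` agree on all
`∏_e U_{m_e}(⟨ρ g_e, ρ y_e⟩)` then they agree on `∏_e Σ_{k<N_e} c_{e,k} U_k(⟨ρ g_e, ρ y_e⟩)`. [folklore] -/
theorem integral_prod_sum_gegenbauer_eq [IsFiniteMeasure μ] [IsFiniteMeasure ν]
    (h : ∀ (g : Edge 3 L → Matrix.specialUnitaryGroup (Fin 2) ℂ) (m : Edge 3 L → ℕ),
      ∫ y, ∏ e, gegenbauerSum 1 (m e) (hsForm 2 (fundamentalRep (Fin 2) (g e)) (fundamentalRep (Fin 2) (y e)) / 2) ∂μ =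
      ∫ y, ∏ e, gegenbauerSum 1 (m e) (hsForm 2 (fundamentalRep (Fin 2) (g e)) (fundamentalRep (Fin 2) (y e)) / 2) ∂ν)
    (g : Edge 3 L → Matrix.specialUnitaryGroup (Fin 2) ℂ) (N : Edge 3 L → ℕ) (c : Edge 3 L → ℕ → ℂ) :
    ∫ y, ∏ e, ∑ k ∈ range (N e), c e k *
        (gegenbauerSum 1 k (hsForm 2 (fundamentalRep (Fin 2) (g e)) (fundamentalRep (Fin 2) (y e)) / 2) : ℂ) ∂μ =
    ∫ y, ∏ e, ∑ k ∈ range (N e), c e k *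
        (gegenbauerSum 1 k (hsForm 2 (fundamentalRep (Fin 2) (g e)) (fundamentalRep (Fin 2) (y e)) / 2) : ℂ) ∂ν := by
  classical
  -- expand the product of sums
  simp_rw [Finset.prod_univ_sum]
  -- each term: `∏_e c_{e,p_e} · ∏_e U_{p_e}`
  have hterm : ∀ (p : (e : Edge 3 L) → ℕ) (y : GaugeConfig 3 L (Matrix.specialUnitaryGroup (Fin 2) ℂ)),
      ∏ e, c e (p e) * (gegenbauerSum 1 (p e) (hsForm 2 (fundamentalRep (Fin 2) (g e)) (fundamentalRep (Fin 2) (y e)) / 2) : ℂ)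
        = (∏ e, c e (p e)) * ((∏ e, gegenbauerSum 1 (p e)
            (hsForm 2 (fundamentalRep (Fin 2) (g e)) (fundamentalRep (Fin 2) (y e)) / 2) : ℝ) : ℂ) := by
    intro p y
    rw [Finset.prod_mul_distrib, Complex.ofReal_prod]
  simp_rw [hterm]
  -- integrability of each term
  have hcontR : ∀ p : (e : Edge 3 L) → ℕ, Continuous fun y : GaugeConfig 3 L (Matrix.specialUnitaryGroup (Fin 2) ℂ) =>
      ∏ e, gegenbauerSum 1 (p e) (hsForm 2 (fundamentalRep (Fin 2) (g e)) (fundamentalRep (Fin 2) (y e)) / 2) := fun p =>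
    continuous_finsetProd _ fun e _ =>
      (Literature.Analysis.SpecialFunctions.continuous_gegenbauerSum 1 (p e)).comp (continuous_latitude (g e) e)
  have hbd : ∀ p : (e : Edge 3 L) → ℕ, ∀ y : GaugeConfig 3 L (Matrix.specialUnitaryGroup (Fin 2) ℂ),
      ‖(∏ e, c e (p e)) * ((∏ e, gegenbauerSum 1 (p e)
        (hsForm 2 (fundamentalRep (Fin 2) (g e)) (fundamentalRep (Fin 2) (y e)) / 2) : ℝ) : ℂ)‖ ≤
        ‖∏ e, c e (p e)‖ * ∏ e, ((p e : ℝ) + 1) := by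
    intro p y
    rw [norm_mul, Complex.norm_real, Real.norm_eq_abs, Finset.abs_prod]
    refine mul_le_mul_of_nonneg_left (prod_le_prod (fun e _ => abs_nonneg _) fun e _ =>
      abs_gegenbauerSum_one_le (p e) ?_) (norm_nonneg _)
    exact abs_le.2 (latitude_mem_Icc (g e) (y e))
  haveI := secondCountableTopology_su2
  haveI := borelSpace_config L
  have hint : ∀ (ρ' : Measure (GaugeConfig 3 L (Matrix.specialUnitaryGroup (Fin 2) ℂ))) [IsFiniteMeasure ρ'],
      ∀ p : (e : Edge 3 L) → ℕ, Integrable (fun y => (∏ e, c e (p e)) * ((∏ e, gegenbauerSum 1 (p e)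
        (hsForm 2 (fundamentalRep (Fin 2) (g e)) (fundamentalRep (Fin 2) (y e)) / 2) : ℝ) : ℂ)) ρ' := by
    intro ρ' _ p
    exact Integrable.of_bound ((continuous_const.mul (Complex.continuous_ofReal.comp (hcontR p))).measurable
      |>.aestronglyMeasurable) _ (Filter.Eventually.of_forall (hbd p))
  rw [integral_finsetSum _ (fun p _ => hint μ p), integral_finsetSum _ (fun p _ => hint ν p)]
  refine Finset.sum_congr rfl fun p _ => ?_
  rw [integral_const_mul, integral_const_mul]
  congr 1
  have h1 : ∀ (ρ' : Measure (GaugeConfig 3 L (Matrix.specialUnitaryGroup (Fin 2) ℂ))),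
      ∫ a, ((∏ e, gegenbauerSum 1 (p e) (hsForm 2 (fundamentalRep (Fin 2) (g e)) (fundamentalRep (Fin 2) (a e)) / 2) : ℝ) : ℂ) ∂ρ'
        = ((∫ a, ∏ e, gegenbauerSum 1 (p e) (hsForm 2 (fundamentalRep (Fin 2) (g e)) (fundamentalRep (Fin 2) (a e)) / 2) ∂ρ'
          : ℝ) : ℂ) := fun ρ' => integral_ofReal
  rw [h1 μ, h1 ν, h g p]

/-- **Ridge characteristic functions agree**: `∫ exp(i Σ_e r_e ⟨ρ g_e, ρ y_e⟩) dμ = ∫ … dν`. [folklore] -/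
theorem integral_cexp_ridge_eq [IsFiniteMeasure μ] [IsFiniteMeasure ν]
    (h : ∀ (g : Edge 3 L → Matrix.specialUnitaryGroup (Fin 2) ℂ) (m : Edge 3 L → ℕ),
      ∫ y, ∏ e, gegenbauerSum 1 (m e) (hsForm 2 (fundamentalRep (Fin 2) (g e)) (fundamentalRep (Fin 2) (y e)) / 2) ∂μ =
      ∫ y, ∏ e, gegenbauerSum 1 (m e) (hsForm 2 (fundamentalRep (Fin 2) (g e)) (fundamentalRep (Fin 2) (y e)) / 2) ∂ν)
    (g : Edge 3 L → Matrix.specialUnitaryGroup (Fin 2) ℂ) (r : Edge 3 L → ℝ) :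
    ∫ y, Complex.exp ((∑ e, r e * (hsForm 2 (fundamentalRep (Fin 2) (g e)) (fundamentalRep (Fin 2) (y e)) / 2) : ℝ) *
        Complex.I) ∂μ =
    ∫ y, Complex.exp ((∑ e, r e * (hsForm 2 (fundamentalRep (Fin 2) (g e)) (fundamentalRep (Fin 2) (y e)) / 2) : ℝ) *
        Complex.I) ∂ν := by
  classical
  haveI := secondCountableTopology_su2
  haveI := borelSpace_config L
  -- abbreviate the latitude
  set s : GaugeConfig 3 L (Matrix.specialUnitaryGroup (Fin 2) ℂ) → Edge 3 L → ℝ := fun y e =>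
    hsForm 2 (fundamentalRep (Fin 2) (g e)) (fundamentalRep (Fin 2) (y e)) / 2 with hs
  have hs_mem : ∀ y e, s y e ∈ Set.Icc (-1 : ℝ) 1 := fun y e => latitude_mem_Icc (g e) (y e)
  have hs_cont : ∀ e, Continuous fun y => s y e := fun e => continuous_latitude (g e) e
  -- the integrand as a product over edges
  have hprod : ∀ y, Complex.exp (((∑ e, r e * s y e : ℝ)) * Complex.I) =
      ∏ e, Complex.exp (((r e * s y e : ℝ)) * Complex.I) := by
    intro y
    rw [← Complex.exp_sum, Complex.ofReal_sum, Finset.sum_mul]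
  simp_rw [show ∀ y e, hsForm 2 (fundamentalRep (Fin 2) (g e)) (fundamentalRep (Fin 2) (y e)) / 2 = s y e from
    fun y e => rfl, hprod]
  -- it suffices to bound the difference by every `ε > 0`
  refine eq_of_forall_dist_le fun ε hε => ?_
  -- one-edge approximants of `cos(r s)`, `sin(r s)` in the `U`-basis, accuracy `δ`
  set K : ℝ := μ.real Set.univ + ν.real Set.univ with hK
  have hK0 : 0 ≤ K := by positivity
  set E : ℕ := Fintype.card (Edge 3 L) with hE
  obtain ⟨δ, hδ0, hδ1, hδ⟩ : ∃ δ : ℝ, 0 < δ ∧ δ ≤ 1 ∧ K * (E * (2 * δ) * (1 + 2 * δ) ^ E) ≤ ε := by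
    refine ⟨min 1 (ε / (K * (E * 2 * 3 ^ E) + 1)), lt_min one_pos (div_pos hε (by positivity)), min_le_left _ _, ?_⟩
    set δ := min 1 (ε / (K * (E * 2 * 3 ^ E) + 1)) with hδdef
    have hδle : δ ≤ ε / (K * (E * 2 * 3 ^ E) + 1) := min_le_right _ _
    have hδ1 : δ ≤ 1 := min_le_left _ _
    have hδ0 : 0 ≤ δ := le_min zero_le_one (div_nonneg hε.le (by positivity))
    have h3 : (1 + 2 * δ) ^ E ≤ (3 : ℝ) ^ E := pow_le_pow_left₀ (by linarith) (by linarith) E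
    calc K * (E * (2 * δ) * (1 + 2 * δ) ^ E) ≤ K * (E * (2 * δ) * 3 ^ E) := by
          refine mul_le_mul_of_nonneg_left (mul_le_mul_of_nonneg_left h3 (by positivity)) hK0
      _ = (K * (E * 2 * 3 ^ E)) * δ := by ring
      _ ≤ (K * (E * 2 * 3 ^ E) + 1) * δ := by nlinarith
      _ ≤ ε := by
          rw [← le_div_iff₀' (by positivity)]
          exact hδle
  have hA : ∀ e, ∃ (N : ℕ) (a : ℕ → ℝ), ∀ x ∈ Set.Icc (-1 : ℝ) 1,
      |Real.cos (r e * x) - ∑ k ∈ range N, a k * gegenbauerSum 1 k x| ≤ δ := fun e =>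
    exists_sum_gegenbauerSum_near ((Real.continuous_cos.comp (continuous_const.mul continuous_id)).continuousOn) hδ0
  have hB : ∀ e, ∃ (N : ℕ) (b : ℕ → ℝ), ∀ x ∈ Set.Icc (-1 : ℝ) 1,
      |Real.sin (r e * x) - ∑ k ∈ range N, b k * gegenbauerSum 1 k x| ≤ δ := fun e =>
    exists_sum_gegenbauerSum_near ((Real.continuous_sin.comp (continuous_const.mul continuous_id)).continuousOn) hδ0
  choose NA a ha using hA
  choose NB b hb using hB
  -- complex approximant on edge `e`: `P_e(x) = Σ_{k<N} (a' + i b') U_k(x)` with a common cut-off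
  set N : Edge 3 L → ℕ := fun e => max (NA e) (NB e) with hN
  set c : Edge 3 L → ℕ → ℂ := fun e k =>
    ((if k < NA e then a e k else 0 : ℝ) : ℂ) + ((if k < NB e then b e k else 0 : ℝ) : ℂ) * Complex.I with hc
  have hP : ∀ e, ∀ x ∈ Set.Icc (-1 : ℝ) 1,
      ‖Complex.exp (((r e * x : ℝ)) * Complex.I) - ∑ k ∈ range (N e), c e k * (gegenbauerSum 1 k x : ℂ)‖ ≤ 2 * δ := by
    intro e x hx
    -- real and imaginary parts
    have hre : (∑ k ∈ range (N e), c e k * (gegenbauerSum 1 k x : ℂ)) =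
        ((∑ k ∈ range (NA e), a e k * gegenbauerSum 1 k x : ℝ) : ℂ) +
          ((∑ k ∈ range (NB e), b e k * gegenbauerSum 1 k x : ℝ) : ℂ) * Complex.I := by
      simp only [hc, add_mul, Finset.sum_add_distrib, Complex.ofReal_sum, Complex.ofReal_mul, Finset.sum_mul]
      congr 1
      · rw [← Finset.sum_subset (Finset.range_subset_range.2 (le_max_left (NA e) (NB e)))]
        · exact Finset.sum_congr rfl fun k hk => by rw [if_pos (Finset.mem_range.1 hk)]
        · intro k _ hk; rw [if_neg (fun h' => hk (Finset.mem_range.2 h'))]; simp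
      · rw [← Finset.sum_subset (Finset.range_subset_range.2 (le_max_right (NA e) (NB e)))]
        · exact Finset.sum_congr rfl fun k hk => by rw [if_pos (Finset.mem_range.1 hk)]; ring
        · intro k _ hk; rw [if_neg (fun h' => hk (Finset.mem_range.2 h'))]; simp
    rw [hre, Complex.exp_mul_I, ← Complex.ofReal_cos, ← Complex.ofReal_sin]
    have hsplit : (Real.cos (r e * x) : ℂ) + (Real.sin (r e * x) : ℂ) * Complex.I -
        (((∑ k ∈ range (NA e), a e k * gegenbauerSum 1 k x : ℝ) : ℂ) +
          ((∑ k ∈ range (NB e), b e k * gegenbauerSum 1 k x : ℝ) : ℂ) * Complex.I) =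
        ((Real.cos (r e * x) - ∑ k ∈ range (NA e), a e k * gegenbauerSum 1 k x : ℝ) : ℂ) +
          ((Real.sin (r e * x) - ∑ k ∈ range (NB e), b e k * gegenbauerSum 1 k x : ℝ) : ℂ) * Complex.I := by
      push_cast; ring
    rw [hsplit]
    calc ‖((Real.cos (r e * x) - ∑ k ∈ range (NA e), a e k * gegenbauerSum 1 k x : ℝ) : ℂ) +
          ((Real.sin (r e * x) - ∑ k ∈ range (NB e), b e k * gegenbauerSum 1 k x : ℝ) : ℂ) * Complex.I‖
        ≤ ‖((Real.cos (r e * x) - ∑ k ∈ range (NA e), a e k * gegenbauerSum 1 k x : ℝ) : ℂ)‖ +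
          ‖((Real.sin (r e * x) - ∑ k ∈ range (NB e), b e k * gegenbauerSum 1 k x : ℝ) : ℂ) * Complex.I‖ :=
          norm_add_le _ _
      _ ≤ δ + δ := by
          rw [norm_mul, Complex.norm_I, mul_one, Complex.norm_real, Complex.norm_real, Real.norm_eq_abs,
            Real.norm_eq_abs]
          exact add_le_add (ha e x hx) (hb e x hx)
      _ = 2 * δ := by ring
  -- pointwise product estimate
  have hpt : ∀ y, ‖∏ e, Complex.exp (((r e * s y e : ℝ)) * Complex.I) -
      ∏ e, ∑ k ∈ range (N e), c e k * (gegenbauerSum 1 k (s y e) : ℂ)‖ ≤ E * (2 * δ) * (1 + 2 * δ) ^ E := by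
    intro y
    have h := norm_prod_sub_prod_le (Finset.univ : Finset (Edge 3 L)) (a := fun e => Complex.exp (((r e * s y e : ℝ)) * Complex.I))
      (b := fun e => ∑ k ∈ range (N e), c e k * (gegenbauerSum 1 k (s y e) : ℂ)) (δ := 2 * δ) (by linarith)
      (fun e _ => by rw [Complex.norm_exp_ofReal_mul_I]) (fun e _ => hP e (s y e) (hs_mem y e))
    simpa [hE] using h
  -- integrals of the approximant agree
  have hPeq := integral_prod_sum_gegenbauer_eq (μ := μ) (ν := ν) h g N c
  -- measurability / integrability
  have hFcont : Continuous fun y : GaugeConfig 3 L (Matrix.specialUnitaryGroup (Fin 2) ℂ) =>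
      ∏ e, Complex.exp (((r e * s y e : ℝ)) * Complex.I) :=
    continuous_finsetProd _ fun e _ => Complex.continuous_exp.comp
      ((Complex.continuous_ofReal.comp (continuous_const.mul (hs_cont e))).mul continuous_const)
  have hPcont : Continuous fun y : GaugeConfig 3 L (Matrix.specialUnitaryGroup (Fin 2) ℂ) =>
      ∏ e, ∑ k ∈ range (N e), c e k * (gegenbauerSum 1 k (s y e) : ℂ) :=
    continuous_finsetProd _ fun e _ => continuous_finsetSum _ fun k _ => continuous_const.mul
      (Complex.continuous_ofReal.comp ((Literature.Analysis.SpecialFunctions.continuous_gegenbauerSum 1 k).comp (hs_cont e)))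
  have hdiff : ∀ (ρ' : Measure (GaugeConfig 3 L (Matrix.specialUnitaryGroup (Fin 2) ℂ))) [IsFiniteMeasure ρ'],
      ‖∫ y, ∏ e, Complex.exp (((r e * s y e : ℝ)) * Complex.I) ∂ρ' -
        ∫ y, ∏ e, ∑ k ∈ range (N e), c e k * (gegenbauerSum 1 k (s y e) : ℂ) ∂ρ'‖ ≤
        (E * (2 * δ) * (1 + 2 * δ) ^ E) * ρ'.real Set.univ := by
    intro ρ' _
    have hiF : Integrable (fun y => ∏ e, Complex.exp (((r e * s y e : ℝ)) * Complex.I)) ρ' :=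
      Integrable.of_bound hFcont.measurable.aestronglyMeasurable 1 (Filter.Eventually.of_forall fun y => by
        rw [norm_prod]; refine prod_le_one (fun e _ => norm_nonneg _) fun e _ => ?_
        rw [Complex.norm_exp_ofReal_mul_I])
    have hiP : Integrable (fun y => ∏ e, ∑ k ∈ range (N e), c e k * (gegenbauerSum 1 k (s y e) : ℂ)) ρ' := by
      refine Integrable.of_bound hPcont.measurable.aestronglyMeasurable (1 + E * (2 * δ) * (1 + 2 * δ) ^ E)
        (Filter.Eventually.of_forall fun y => ?_)
      have h1 := hpt y
      have h2 : ‖∏ e, Complex.exp (((r e * s y e : ℝ)) * Complex.I)‖ ≤ 1 := by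
        rw [norm_prod]; refine prod_le_one (fun e _ => norm_nonneg _) fun e _ => ?_
        rw [Complex.norm_exp_ofReal_mul_I]
      calc ‖∏ e, ∑ k ∈ range (N e), c e k * (gegenbauerSum 1 k (s y e) : ℂ)‖
          = ‖∏ e, Complex.exp (((r e * s y e : ℝ)) * Complex.I) - (∏ e, Complex.exp (((r e * s y e : ℝ)) * Complex.I) -
              ∏ e, ∑ k ∈ range (N e), c e k * (gegenbauerSum 1 k (s y e) : ℂ))‖ := by rw [sub_sub_cancel]
        _ ≤ 1 + E * (2 * δ) * (1 + 2 * δ) ^ E := (norm_sub_le _ _).trans (add_le_add h2 h1)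
    rw [← integral_sub hiF hiP]
    have h := norm_integral_le_of_norm_le_const (μ := ρ') (C := E * (2 * δ) * (1 + 2 * δ) ^ E)
      (Filter.Eventually.of_forall fun y => hpt y)
    exact h
  have hμ := hdiff μ
  have hν := hdiff ν
  rw [dist_eq_norm]
  have hsplit : ∫ y, ∏ e, Complex.exp (((r e * s y e : ℝ)) * Complex.I) ∂μ -
      ∫ y, ∏ e, Complex.exp (((r e * s y e : ℝ)) * Complex.I) ∂ν =
      (∫ y, ∏ e, Complex.exp (((r e * s y e : ℝ)) * Complex.I) ∂μ -
        ∫ y, ∏ e, ∑ k ∈ range (N e), c e k * (gegenbauerSum 1 k (s y e) : ℂ) ∂μ) -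
      (∫ y, ∏ e, Complex.exp (((r e * s y e : ℝ)) * Complex.I) ∂ν -
        ∫ y, ∏ e, ∑ k ∈ range (N e), c e k * (gegenbauerSum 1 k (s y e) : ℂ) ∂ν) := by
    rw [hPeq]; ring
  rw [hsplit]
  calc ‖(∫ y, ∏ e, Complex.exp (((r e * s y e : ℝ)) * Complex.I) ∂μ -
          ∫ y, ∏ e, ∑ k ∈ range (N e), c e k * (gegenbauerSum 1 k (s y e) : ℂ) ∂μ) -
        (∫ y, ∏ e, Complex.exp (((r e * s y e : ℝ)) * Complex.I) ∂ν -
          ∫ y, ∏ e, ∑ k ∈ range (N e), c e k * (gegenbauerSum 1 k (s y e) : ℂ) ∂ν)‖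
      ≤ (E * (2 * δ) * (1 + 2 * δ) ^ E) * μ.real Set.univ + (E * (2 * δ) * (1 + 2 * δ) ^ E) * ν.real Set.univ :=
        (norm_sub_le _ _).trans (add_le_add hμ hν)
    _ = K * (E * (2 * δ) * (1 + 2 * δ) ^ E) := by rw [hK]; ring
    _ ≤ ε := hδ

end Moments

end Summit.QuantumFields.YangMills.Theorems.ColdStartUniversality

end
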